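import Literature.Probability.MarkovChains.TetaliHittingTimeFormula
import Literature.Probability.MarkovChains.RegularGraphCommuteTime
import Literature.Probability.NegativeDependence.CompleteGraphTransferCurrents
import HarnessLib

/-!
# Kemeny's constant through effective resistances: `𝒦(G) = dᵀRd/(4m)` (Palacios–Renom), its network form
# `t⊙ = Σ_x Σ_y c(x)c(y)𝓡(x ↔ y)/(2c_G)`, the regular and complete-graph values

Sources (read at the page). N. Faught, M. Kempton, A. Knudson, *A 1-separation formula for the graph Kemeny
constant and Braess edges*, J. Math. Chem. 60 (2022) 49–69, arXiv:2108.01061 [FaughtKemptonKnudson2021] (held text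
`paper:arxiv-2108.01061`, p0003–p0004, p0009; VERBATIM): «Kemeny's constant of a Markov chain `P` is computed with the
sum `𝒦(P) = Σ_j π_j m_ij`, where `π_j` is the `j`-th entry of the stationary distribution of the Markov chain and `m_ij` is
the hitting time of `j` for a random walk with initial state `i`»; **Lemma 1.1 (= Lemma 1.5) (Corollary 1 of
[palacios2011broder])** «Suppose that `G = (V, E)` is a simple connected graph, where `R` denotes the matrix whose
`(i, j)`-th entry is the effective resistance between `i` and `j`, `d` the vector whose `i`-th entry is the degree of
vertex `i`, and `m = |E|`. Kemeny's constant of the graph is related to the effective resistance by the identity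
`𝒦(G) = dᵀRd/(4m) = (1/4m) Σ_{i,j ∈ G} d_i d_j r_G(i, j)`»; Definition 1.6 «The moment of a graph `G` at vertex `v` is
given by `μ(G, v) = dᵀRe_v = Σ_{i ∈ V(G)} d_i r_G(i,v)`»; **Proposition 3.2** «`𝒦(K_n) = (n−1)²/n` […]
`μ(K_n, j) = 2(n−1)²/n`» (with Prop. 3.1 / Lemma 3.4 `r_{K_n}(i,j) = 2/n`). The original of Lemma 1.1 is J. L. Palacios,
J. M. Renom, *Broder and Karlin's formula for hitting times and the Kirchhoff index*, Int. J. Quantum Chem. 111 (2011)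
35–39 [PalaciosRenom2010], Corollary 1 (not held: acquisition request acq-14433; cited through the restatement above).
The regular case `𝒦 = (d/n)·Kf` is the form recalled in R. E. Kooij, J. L. A. Dubbeldam, Discrete Appl. Math. 285
(2020) 96–107, §3 eq. (31), and P. Van Mieghem, *Graph Spectra for Complex Networks* (2nd ed.) [VanMieghem2023] §5.3
(after (5.21)) / §8 (8.18) recalls «the Kemeny constant `K_G = dᵀΩd/(4L)` in Wang et al. (2017)».

## Tree vocabulary

`IsHittingTimeSolution P h` (`h i j = m_ij = E_i τ_j`, `h i i = 0`; unique for irreducible `P`,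
`IsHittingTimeSolution.unique` / `exists_isHittingTimeSolution`), `targetTime π h i = Σ_j h i j · π j = Σ_j π_j m_ij = 𝒦`
(the book's `t⊙` of [LevinPeres2017, §10.2]; independent of `i` by the Random Target Lemma `LevinPeres2017_lemma_10_1`),
the network walk `networkKernel c` with stationary law `networkLaw c = c(·)/c_G`, `effectiveResistance c x y = 𝓡(x ↔ y)`,
`commuteTime h x y = m_xy + m_yx`; for a simple graph `G`: `srwKernel G = networkKernel (G.adjMatrix ℝ)`
(`networkKernel_adjMatrix`), `degreeLaw G = networkLaw (G.adjMatrix ℝ)` (`networkLaw_adjMatrix`), `d_i = G.degree i`,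
`m = #G.edgeFinset`, `r_G(i,j) = effectiveResistance (G.adjMatrix ℝ) i j`.

## What is formalised, and the route

DECLARED ROUTE (the cited papers derive Lemma 1.1 from hitting-time formulas / the pseudoinverse `L†`; here the two
tree ingredients give it in three lines, for every finite irreducible chain first): by the Random Target Lemma
`𝒦 = Σ_i π_i 𝒦 = Σ_i Σ_j π_i π_j m_ij` (`targetTime_eq_sum_sum`), hence **`2𝒦 = Σ_i Σ_j π_i π_j (m_ij + m_ji)`**
(`two_mul_targetTime_eq_sum_sum_commuteTime`, any irreducible chain with stationary distribution `π`); on a network the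
Commute Time Identity `m_xy + m_yx = c_G 𝓡(x ↔ y)` ([LevinPeres2017, Prop. 10.7], `LevinPeres2017_prop_10_7`) and
`π = c(·)/c_G` give the NETWORK FORM **`𝒦 = Σ_x Σ_y c(x)c(y)𝓡(x ↔ y) / (2c_G)`** (`targetTime_networkLaw_eq`), and
with `c = ` adjacency (`c(x) = d_x`, `c_G = 2m`) **LEMMA 1.1 / Palacios–Renom Corollary 1**
`𝒦(G) = (1/4m) Σ_{i,j} d_i d_j r_G(i,j)` (`PalaciosRenom2010_cor_1`); consequences: the `d`-regular value
`𝒦 = (d/n) · Kf(G)` with `Kf = ½ Σ_i Σ_j r_G(i,j)` (`targetTime_regular`), and **Proposition 3.2 for `K_n`**: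
`μ(K_n, j) = Σ_i d_i r(i,j) = 2(n−1)²/n` (`FaughtKemptonKnudson2021_prop_3_2_moment_complete`) and
`𝒦(K_n) = (n−1)²/n` (`FaughtKemptonKnudson2021_prop_3_2_complete`), from the tree's `r_{K_n}(i,j) = 2/n`
(`effectiveResistance_top`).

NOT CLAIMED: the path and star values of Prop. 3.2, the 1-separation formula (Thm. 2.x of the paper), Braess edges;
the identification of `h` with path-space expectations (as everywhere in this directory). THEOREMS ONLY (no definition,
no named fact, net debt 0).
-/

noncomputable section

open Finset Matrix SimpleGraph
open Literature.Probability.NegativeDependence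

namespace Literature.Probability.MarkovChains

/-! ## §1 Any irreducible chain: `𝒦 = Σ_i Σ_j π_i π_j m_ij`, `2𝒦 = Σ_i Σ_j π_i π_j (m_ij + m_ji)` -/

section Chain

variable {X : Type*} [Fintype X] [DecidableEq X] {P : Matrix X X ℝ} {π : X → ℝ} {h : X → X → ℝ}

/-- **`𝒦 = Σ_i π_i 𝒦 = Σ_i Σ_j π_i π_j m_ij`**: averaging the start of the (start-independent) Kemeny constant over `π`.
[cite: FaughtKemptonKnudson2021, §1 («`𝒦(P) = Σ_j π_j m_ij`», independent of `i`)] [cite: LevinPeres2017, §10.2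
Lemma 10.1 (Random Target Lemma)] -/
theorem targetTime_eq_sum_sum (hP : IsRowStochastic P) (hirr : IsIrreducible P) (hπ : IsStationary π P)
    (hπ1 : ∑ x, π x = 1) (hh : IsHittingTimeSolution P h) (b : X) :
    targetTime π h b = ∑ i, ∑ j, π i * π j * h i j := by
  calc targetTime π h b = ∑ i, π i * targetTime π h b := by rw [← sum_mul, hπ1, one_mul]
    _ = ∑ i, π i * targetTime π h i :=
        sum_congr rfl fun i _ => by rw [LevinPeres2017_lemma_10_1 hP hirr hπ hπ1 hh b i]
    _ = ∑ i, ∑ j, π i * π j * h i j := sum_congr rfl fun i _ => by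
        rw [targetTime_def, mul_sum]
        exact sum_congr rfl fun j _ => by ring

/-- **`2𝒦 = Σ_i Σ_j π_i π_j (m_ij + m_ji)`**: the symmetrised form, with the commute times `m_ij + m_ji`.
[cite: FaughtKemptonKnudson2021, §1.1 Lemma 1.1 (the step from hitting times to the symmetric resistance matrix)]
[cite: LevinPeres2017, §10.2 Lemma 10.1, §10.3 (commute time `t_{a↔b}`)] -/
theorem two_mul_targetTime_eq_sum_sum_commuteTime (hP : IsRowStochastic P) (hirr : IsIrreducible P)
    (hπ : IsStationary π P) (hπ1 : ∑ x, π x = 1) (hh : IsHittingTimeSolution P h) (b : X) :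
    2 * targetTime π h b = ∑ i, ∑ j, π i * π j * commuteTime h i j := by
  have h1 := targetTime_eq_sum_sum hP hirr hπ hπ1 hh b
  have h2 : targetTime π h b = ∑ i, ∑ j, π i * π j * h j i := by
    rw [h1, sum_comm]
    exact sum_congr rfl fun i _ => sum_congr rfl fun j _ => by ring
  have h3 : 2 * targetTime π h b = (∑ i, ∑ j, π i * π j * h i j) + ∑ i, ∑ j, π i * π j * h j i := by
    rw [two_mul, ← h1, ← h2]
  rw [h3, ← sum_add_distrib]
  refine sum_congr rfl fun i _ => ?_
  rw [← sum_add_distrib]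
  exact sum_congr rfl fun j _ => by rw [commuteTime_def]; ring

end Chain

/-! ## §2 Networks: `𝒦 = Σ_x Σ_y c(x)c(y)𝓡(x ↔ y)/(2c_G)` -/

section Network

variable {X : Type*} [Fintype X] [DecidableEq X] {c : Matrix X X ℝ} {h : X → X → ℝ}

omit [Fintype X] [DecidableEq X] in
/-- `2t = S/G ⟹ t = S/(2G)`. [folklore] -/
private theorem half_of_two_mul_eq_div_mul {t S G : ℝ} (h2 : 2 * t = 1 / G * S) : t = 1 / (2 * G) * S := by
  have ht : t = 1 / 2 * (2 * t) := by ring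
  rw [ht, h2]
  ring

/-- **Kemeny's constant of a network walk through effective resistances**: for the random walk on a finite connected
network with conductances `c` (`π = c(·)/c_G`), `𝒦 = Σ_j π_j m_ij = (1/(2c_G)) Σ_x Σ_y c(x) c(y) 𝓡(x ↔ y)` — Lemma 1.1
with weighted degrees `c(x)` and `2m = c_G` (from §1 and the Commute Time Identity `m_xy + m_yx = c_G 𝓡(x ↔ y)`).
[cite: FaughtKemptonKnudson2021, §1.1 Lemma 1.1 (unit conductances)] [cite: PalaciosRenom2010, Cor. 1]
[cite: LevinPeres2017, §10.3 Prop. 10.7 (Commute Time Identity)] -/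
theorem targetTime_networkLaw_eq [Nonempty X] (hc : IsConductance c) (hirr : IsIrreducible (networkKernel c))
    (hh : IsHittingTimeSolution (networkKernel c) h) (b : X) :
    targetTime (networkLaw c) h b = 1 / (2 * totalConductance c) *
      ∑ x, ∑ y, nodeConductance c x * nodeConductance c y * effectiveResistance c x y := by
  have hG := hc.totalConductance_pos
  have h2 := two_mul_targetTime_eq_sum_sum_commuteTime (networkKernel_isRowStochastic hc) hirr
    (networkLaw_isStationary hc) (sum_networkLaw hc) hh b
  simp_rw [LevinPeres2017_prop_10_7 hc hirr hh, networkLaw_apply] at h2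
  have h3 : ∑ x, ∑ y, nodeConductance c x / totalConductance c * (nodeConductance c y / totalConductance c) *
      (totalConductance c * effectiveResistance c x y) =
      1 / totalConductance c * ∑ x, ∑ y, nodeConductance c x * nodeConductance c y * effectiveResistance c x y := by
    rw [mul_sum]
    refine sum_congr rfl fun x _ => ?_
    rw [mul_sum]
    refine sum_congr rfl fun y _ => ?_
    field_simp
  rw [h3] at h2
  exact half_of_two_mul_eq_div_mul h2

end Network

/-! ## §3 Simple graphs: Lemma 1.1 `𝒦(G) = dᵀRd/(4m)`, the regular value, and `K_n` -/

section Graph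

variable {V : Type*} [Fintype V] [DecidableEq V] {G : SimpleGraph V} [DecidableRel G.Adj] {h : V → V → ℝ}

/-- **LEMMA 1.1 (Corollary 1 of Palacios–Renom)**: «Suppose that `G = (V, E)` is a simple connected graph, where `R`
denotes the matrix whose `(i, j)`-th entry is the effective resistance between `i` and `j`, `d` the vector whose `i`-th
entry is the degree of vertex `i`, and `m = |E|`. Kemeny's constant of the graph is related to the effective resistance
by the identity `𝒦(G) = dᵀRd/(4m) = (1/4m) Σ_{i,j ∈ G} d_i d_j r_G(i, j)`» — with `𝒦(G) = Σ_j π_j m_ij` for the simple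
random walk (`π_j = d_j/2m`, `m_ij` its hitting times, any start `i`). [cite: FaughtKemptonKnudson2021, §1.1 Lemma 1.1]
[cite: PalaciosRenom2010, Cor. 1] -/
theorem PalaciosRenom2010_cor_1 [Nontrivial V] (hG : G.Connected) (hh : IsHittingTimeSolution (srwKernel G) h)
    (i : V) :
    targetTime (degreeLaw G) h i = 1 / (4 * (#G.edgeFinset : ℝ)) *
      ∑ x, ∑ y, (G.degree x : ℝ) * (G.degree y : ℝ) * effectiveResistance (G.adjMatrix ℝ) x y := by
  have hc := isConductance_adjMatrix (degree_pos_of_connected hG)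
  have hirr : IsIrreducible (networkKernel (G.adjMatrix ℝ)) := by
    rw [networkKernel_adjMatrix]
    exact srwKernel_isIrreducible_iff.2 hG.preconnected
  have hh' : IsHittingTimeSolution (networkKernel (G.adjMatrix ℝ)) h := by
    rwa [networkKernel_adjMatrix]
  have h1 := targetTime_networkLaw_eq hc hirr hh' i
  rw [networkLaw_adjMatrix, totalConductance_adjMatrix] at h1
  simp_rw [nodeConductance_adjMatrix] at h1
  rw [h1]
  congr 1
  ring

/-- **The `d`-regular case: `𝒦(G) = (d/n) · Kf(G)`** with the Kirchhoff index `Kf(G) = ½ Σ_i Σ_j r_G(i,j)` (`d_i = d`,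
`2m = nd` in Lemma 1.1). [cite: FaughtKemptonKnudson2021, §1.1 Lemma 1.1 (specialised to `d = d·1`)]
[cite: VanMieghem2023, §8 (8.18) («relates to the Kemeny constant `K_G = dᵀΩd/(4L)`»)] -/
theorem targetTime_regular [Nontrivial V] (hG : G.Connected) {d : ℕ} (hreg : G.IsRegularOfDegree d)
    (hh : IsHittingTimeSolution (srwKernel G) h) (i : V) :
    targetTime (degreeLaw G) h i =
      (d : ℝ) / (Fintype.card V : ℝ) * ((1 / 2 : ℝ) * ∑ x, ∑ y, effectiveResistance (G.adjMatrix ℝ) x y) := by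
  have hn : (0 : ℝ) < Fintype.card V := Nat.cast_pos.2 Fintype.card_pos
  have hd : (0 : ℝ) < d := by
    obtain ⟨x⟩ := hG.nonempty
    have := degree_pos_of_connected hG x
    rw [hreg.degree_eq x] at this
    exact_mod_cast this
  -- `2m = nd`
  have hm : 2 * (#G.edgeFinset : ℝ) = (Fintype.card V : ℝ) * d := by
    rw [← totalConductance_adjMatrix, totalConductance_adjMatrix_regular hreg]
  rw [PalaciosRenom2010_cor_1 hG hh i]
  simp_rw [hreg.degree_eq]
  rw [show (4 : ℝ) * (#G.edgeFinset : ℝ) = 2 * (2 * (#G.edgeFinset : ℝ)) by ring, hm]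
  simp_rw [← Finset.mul_sum]
  field_simp

/-- **PROPOSITION 3.2, the moment of `K_n`**: «`μ(K_n, j) = 2(n−1)²/n`», `μ(G, v) = Σ_{i ∈ V(G)} d_i r_G(i,v)`
(Definition 1.6), from `r_{K_n}(i,j) = 2/n` (Prop. 3.1). [cite: FaughtKemptonKnudson2021, §3 Prop. 3.2 with Def. 1.6
and Prop. 3.1] -/
theorem FaughtKemptonKnudson2021_prop_3_2_moment_complete [Nontrivial V] (j : V) :
    ∑ i, ((⊤ : SimpleGraph V).degree i : ℝ) * effectiveResistance ((⊤ : SimpleGraph V).adjMatrix ℝ) i j =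
      2 * ((Fintype.card V : ℝ) - 1) ^ 2 / (Fintype.card V : ℝ) := by
  have hn : (Fintype.card V : ℝ) ≠ 0 := Nat.cast_ne_zero.2 Fintype.card_ne_zero
  have hdeg : ∀ i : V, ((⊤ : SimpleGraph V).degree i : ℝ) = (Fintype.card V : ℝ) - 1 := fun i => by
    rw [IsRegularOfDegree.top i, Nat.cast_sub Fintype.card_pos, Nat.cast_one]
  have hr : ∀ i : V, effectiveResistance ((⊤ : SimpleGraph V).adjMatrix ℝ) i j =
      2 / (Fintype.card V : ℝ) - if i = j then 2 / (Fintype.card V : ℝ) else 0 := fun i => by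
    split_ifs with hij
    · rw [hij, effectiveResistance_self, sub_self]
    · rw [effectiveResistance_top hij, sub_zero]
  simp_rw [hdeg, hr, ← Finset.mul_sum, Finset.sum_sub_distrib, Finset.sum_ite_eq' univ j, if_pos (mem_univ j),
    Finset.sum_const, Finset.card_univ, nsmul_eq_mul]
  field_simp

/-- **PROPOSITION 3.2 for the complete graph**: «`𝒦(K_n) = (n−1)²/n`» — Kemeny's constant `Σ_j π_j m_ij` of the simple
random walk on `K_n` (`n ≥ 2`), by Lemma 1.1 with `d_i = n − 1`, `m = n(n−1)/2`, `r_{K_n}(i,j) = 2/n`.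
[cite: FaughtKemptonKnudson2021, §3 Prop. 3.2 (with Lemma 1.1 and Prop. 3.1)] -/
theorem FaughtKemptonKnudson2021_prop_3_2_complete [Nontrivial V]
    (hh : IsHittingTimeSolution (srwKernel (⊤ : SimpleGraph V)) h) (i : V) :
    targetTime (degreeLaw (⊤ : SimpleGraph V)) h i = ((Fintype.card V : ℝ) - 1) ^ 2 / (Fintype.card V : ℝ) := by
  have hn : (Fintype.card V : ℝ) ≠ 0 := Nat.cast_ne_zero.2 Fintype.card_ne_zero
  have hn1 : (Fintype.card V : ℝ) - 1 ≠ 0 := by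
    have h1 : (1 : ℝ) < Fintype.card V := Nat.one_lt_cast.2 Fintype.one_lt_card
    linarith
  have hdeg : ∀ x : V, ((⊤ : SimpleGraph V).degree x : ℝ) = (Fintype.card V : ℝ) - 1 := fun x => by
    rw [IsRegularOfDegree.top x, Nat.cast_sub Fintype.card_pos, Nat.cast_one]
  rw [PalaciosRenom2010_cor_1 connected_top hh i]
  have hinner : ∀ y : V, ∑ x, ((⊤ : SimpleGraph V).degree x : ℝ) * ((⊤ : SimpleGraph V).degree y : ℝ) *
      effectiveResistance ((⊤ : SimpleGraph V).adjMatrix ℝ) x y =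
      ((Fintype.card V : ℝ) - 1) * (2 * ((Fintype.card V : ℝ) - 1) ^ 2 / (Fintype.card V : ℝ)) := fun y => by
    rw [← FaughtKemptonKnudson2021_prop_3_2_moment_complete y, Finset.mul_sum]
    exact sum_congr rfl fun x _ => by rw [hdeg y]; ring
  rw [sum_comm]
  simp_rw [hinner, Finset.sum_const, Finset.card_univ, nsmul_eq_mul]
  rw [card_edgeFinset_top_eq_card_choose_two, Nat.cast_choose_two (K := ℝ)]
  field_simp
  ring

end Graph

end Literature.Probability.MarkovChains
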